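import Summits.BirchSwinnertonDyer.BirchSwinnertonDyer.Theorems.KimAtThreeD7uRefinedData
import Summits.BirchSwinnertonDyer.BirchSwinnertonDyer.Theorems.KimAtThreeD7uRefinedTate
import Literature.NumberTheory.GaloisRepresentations.ConjugationDescent
import HarnessLib

/-!
# D7-u, file C1: the KEY LEMMA — cohomologous `T`-cocycles give refined data that agree modulo
# null data (route W2 = `KimAtThreeKolyvagin`, crux 19560 (C3) / TamDiv∞; seat `bsd-addord-w2-tamdiv`)

Files A/B (`KimAtThreeD7uRefinedData`, `KimAtThreeD7uRefinedTate`) set up refined data `(z, η)`,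
null data, the conjugation action and the refined reduction `ρ̂(c, s) = (red ∘ c, g ↦ red(s_g))` of a
`T`-cocycle `c` on `U` trivialised above the place by `s`.  This file proves that `ρ̂` descends to
an EQUIVARIANT map on cohomology classes:

* `null_rhoHat_sub_conj_rhoHat` (**KEY**): if `[c'] = g · [c]` in `H¹(U, T)` and `s`, `s'`
  trivialise `c`, `c'`, then `ρ̂(c', s') − g · ρ̂(c, s)` is NULL (`= (dα, ≡ ·⁻¹α mod B)` with
  `α = red θ`, `θ` the coboundary witness).  With `g = 1`: the class of `ρ̂(c, s)` modulo null data
  depends only on `[c]`.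
* `data_sum` / `rhoHat_sum_fst` / `rhoHat_sum_snd`: finite sums of trivialised cocycles are
  trivialised by the sum of the data, and `ρ̂` is additive on the nose — used to transport the
  Euler-system norm relations (finite sums of conjugates) from `H¹(U, T)` to the refined group.

References: K. Rubin, *Euler Systems* (2000), §4.4–§4.6; B. Mazur, K. Rubin, Mem. AMS 799 (2004),
App. A Remark A.5.
-/

set_option autoImplicit false
-- the Theorems namespace of a single-conjunct summit repeats the summit name by design (D-0017)
set_option linter.dupNamespace false

noncomputable section

open CategoryTheory Function Finset
open Literature.NumberTheory.GaloisRepresentations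
open Literature.NumberTheory.EllipticCurves (subgroupConj subgroupConj_apply_coe)

universe u v

namespace Summit.BirchSwinnertonDyer.BirchSwinnertonDyer.Theorems.KimAtThreeD7uRefined

variable {R : Type v} [CommRing R] [TopologicalSpace R]
variable {G : Type u} [Group G] [TopologicalSpace G] [IsTopologicalGroup G]
variable (X T : TopRep.{u} R G) (U : Subgroup G) [U.Normal]

/-- Local notation: `𝔠⟦Y, g⟧ z` = the conjugate cocycle `x ↦ g • z(g⁻¹ x g)` on `U`. -/
local notation3 "𝔠⟦" Y ", " g "⟧" => contOneCocycles.pullback (subgroupConj U g) (conjRepHom Y U g)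

/-- Local notation: `𝐫⟦red⟧ c` = the reduced cocycle `red ∘ c` on `U`. -/
local notation3 "𝐫⟦" red "⟧" => contOneCocycles.pullback (ContinuousMonoidHom.id _)
    (X := subgroupRep T U) (Y := subgroupRep X U) ((TopRep.resFunctor (Subgroup.subtype U)).map red)

variable (B : Submodule R X) (I : Subgroup G) (red : T ⟶ X)
variable (hIU : ∀ (g τ : G), τ ∈ I → g * τ * g⁻¹ ∈ U)

/-! ### §1 The key lemma -/

/-- **KEY LEMMA.**  Let `c, c'` be continuous crossed homomorphisms `U → T` with
`[c'] = g · [c]` in `H¹(U, T)`, trivialised above the place by `s` and `s'`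
(`h⁻¹ c(h τ h⁻¹) = τ s_h − s_h` on `I`, same for `c', s'`), and suppose `red(T^I) ⊆ B`.  Then the
refined reductions satisfy: `ρ̂(c', s') − g · ρ̂(c, s)` is NULL — there is `α ∈ X` (namely
`α = red θ` for a coboundary witness `θ`) with `red ∘ c' − g · (red ∘ c) = dα` and
`red(s'_h) − red(s_{g⁻¹ h}) ≡ h⁻¹ α (mod B)` for all `h`.  In particular (`g = 1`) the class of
`ρ̂(c, s)` modulo null data depends only on the cohomology class of `c`.
[cite: MazurRubin2004, App. A Remark A.5] -/
theorem null_rhoHat_sub_conj_rhoHat (hB : ∀ t : T, (∀ τ ∈ I, T.ρ τ t = t) → red.hom t ∈ B)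
    (c c' : contOneCocycles (subgroupRep T U)) (g : G)
    (hcc' : oneCocycleClass (subgroupRep T U) c' = conjMap T U g 1 (oneCocycleClass (subgroupRep T U) c))
    (s s' : G → T)
    (hs : ∀ (h τ : G) (hτ : τ ∈ I), T.ρ h⁻¹ (c.1 ⟨h * τ * h⁻¹, hIU h τ hτ⟩) = T.ρ τ (s h) - s h)
    (hs' : ∀ (h τ : G) (hτ : τ ∈ I), T.ρ h⁻¹ (c'.1 ⟨h * τ * h⁻¹, hIU h τ hτ⟩) = T.ρ τ (s' h) - s' h) :
    ∃ α : X, (∀ x : U, (𝐫⟦red⟧ c' - 𝔠⟦X, g⟧ (𝐫⟦red⟧ c)).1 x = X.ρ (x : G) α - α) ∧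
      ∀ h : G, (red.hom (s' h) - red.hom (s (g⁻¹ * h))) - X.ρ h⁻¹ α ∈ B := by
  -- the coboundary witness `θ`: `c' = g · c + dθ`
  rw [conjMap_oneCocycleClass, ← sub_eq_zero, ← oneCocycleClass_sub, oneCocycleClass_eq_zero_iff] at hcc'
  obtain ⟨θ, hθ⟩ := hcc'
  have hc' : ∀ x : U, c'.1 x = (𝔠⟦T, g⟧ c).1 x + (T.ρ (x : G) θ - θ) := by
    intro x
    have h := hθ x
    rw [Submodule.coe_sub, ContinuousMap.sub_apply, sub_eq_iff_eq_add'] at h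
    rw [h]
    rfl
  -- data for `g · c` and for `c' = g · c + dθ`
  have hs₁ := data_conj T U I hIU c s hs g
  have hs₂ := data_of_coboundary T U I hIU (𝔠⟦T, g⟧ c) c' θ hc' (fun h => s (g⁻¹ * h)) hs₁
  refine ⟨red.hom θ, fun x => ?_, fun h => ?_⟩
  · rw [← red_conj X T U red g c]
    exact red_of_coboundary X T U red (𝔠⟦T, g⟧ c) c' θ hc' x
  · have h1 := sub_mem_of_data X T U B I red hIU hB c' s' (fun h => s (g⁻¹ * h) + T.ρ h⁻¹ θ) hs' hs₂ h
    have h2 := eta_of_coboundary X T B red θ (fun h => s (g⁻¹ * h)) h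
    have e : red.hom (s' h) - red.hom (s (g⁻¹ * h)) - X.ρ h⁻¹ (red.hom θ) =
        (red.hom (s' h) - red.hom (s (g⁻¹ * h) + T.ρ h⁻¹ θ)) +
          (red.hom (s (g⁻¹ * h) + T.ρ h⁻¹ θ) - red.hom (s (g⁻¹ * h)) - X.ρ h⁻¹ (red.hom θ)) := by
      abel
    rw [e]
    exact B.add_mem h1 h2

/-- The case `g = 1` of the key lemma: two representatives / two trivialisations of the same
class give refined reductions that differ by null data. [folklore] -/
theorem null_rhoHat_sub_rhoHat (hB : ∀ t : T, (∀ τ ∈ I, T.ρ τ t = t) → red.hom t ∈ B)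
    (c c' : contOneCocycles (subgroupRep T U))
    (hcc' : oneCocycleClass (subgroupRep T U) c' = oneCocycleClass (subgroupRep T U) c)
    (s s' : G → T)
    (hs : ∀ (h τ : G) (hτ : τ ∈ I), T.ρ h⁻¹ (c.1 ⟨h * τ * h⁻¹, hIU h τ hτ⟩) = T.ρ τ (s h) - s h)
    (hs' : ∀ (h τ : G) (hτ : τ ∈ I), T.ρ h⁻¹ (c'.1 ⟨h * τ * h⁻¹, hIU h τ hτ⟩) = T.ρ τ (s' h) - s' h) :
    ∃ α : X, (∀ x : U, (𝐫⟦red⟧ c' - 𝐫⟦red⟧ c).1 x = X.ρ (x : G) α - α) ∧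
      ∀ h : G, (red.hom (s' h) - red.hom (s h)) - X.ρ h⁻¹ α ∈ B := by
  have h1 : oneCocycleClass (subgroupRep T U) c' =
      conjMap T U 1 1 (oneCocycleClass (subgroupRep T U) c) := by
    rw [hcc', conjMap_one_one]
  obtain ⟨α, hα, hη⟩ := null_rhoHat_sub_conj_rhoHat X T U B I red hIU hB c c' 1 h1 s s' hs hs'
  refine ⟨α, fun x => ?_, fun h => ?_⟩
  · rw [← hα x, Submodule.coe_sub, Submodule.coe_sub, ContinuousMap.sub_apply,
      ContinuousMap.sub_apply]
    congr 1
    rw [conj_apply]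
    change _ = X.ρ 1 ((𝐫⟦red⟧ c).1 _)
    rw [map_one, one_apply_eq_self]
    exact congrArg _ (Subtype.ext (by change (x : G) = 1⁻¹ * x * 1; group))
  · have h2 := hη h
    rwa [inv_one, one_mul] at h2

/-! ### §2 Finite sums of trivialised cocycles -/

omit [IsTopologicalGroup G] [U.Normal] in
/-- **Sums of trivialised cocycles are trivialised by the sums of the data.** [folklore] -/
theorem data_sum {κ : Type*} (J : Finset κ) (c : κ → contOneCocycles (subgroupRep T U))
    (s : κ → G → T)
    (hs : ∀ j ∈ J, ∀ (h τ : G) (hτ : τ ∈ I),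
      T.ρ h⁻¹ ((c j).1 ⟨h * τ * h⁻¹, hIU h τ hτ⟩) = T.ρ τ (s j h) - s j h)
    (h τ : G) (hτ : τ ∈ I) :
    T.ρ h⁻¹ ((∑ j ∈ J, c j).1 ⟨h * τ * h⁻¹, hIU h τ hτ⟩) =
      T.ρ τ ((∑ j ∈ J, s j) h) - (∑ j ∈ J, s j) h := by
  classical
  induction J using Finset.induction_on generalizing h τ hτ with
  | empty => simp
  | insert a J ha ih =>
    rw [Finset.sum_insert ha, Finset.sum_insert ha]
    exact data_add T U I hIU (c a) (∑ j ∈ J, c j) (s a) (∑ j ∈ J, s j)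
      (hs a (Finset.mem_insert_self a J))
      (fun h' τ' hτ' => ih (fun j hj => hs j (Finset.mem_insert_of_mem hj)) h' τ' hτ') h τ hτ

omit [IsTopologicalGroup G] [U.Normal] in
/-- `ρ̂` is additive on the nose, first component: `red ∘ (Σ c_j) = Σ red ∘ c_j`. [folklore] -/
theorem rhoHat_sum_fst {κ : Type*} (J : Finset κ) (c : κ → contOneCocycles (subgroupRep T U)) :
    𝐫⟦red⟧ (∑ j ∈ J, c j) = ∑ j ∈ J, 𝐫⟦red⟧ (c j) := by
  classical
  induction J using Finset.induction_on with
  | empty =>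
    rw [Finset.sum_empty, Finset.sum_empty]
    apply Subtype.ext; ext x
    rw [red_apply]
    change red.hom 0 = 0
    rw [map_zero]
  | insert a J ha ih => rw [Finset.sum_insert ha, Finset.sum_insert ha, red_add, ih]

omit [TopologicalSpace G] [IsTopologicalGroup G] [U.Normal] in
/-- `ρ̂` is additive on the nose, second component: `red((Σ s_j) h) = Σ red(s_j h)`. [folklore] -/
theorem rhoHat_sum_snd {κ : Type*} (J : Finset κ) (s : κ → G → T) (h : G) :
    red.hom ((∑ j ∈ J, s j) h) = ∑ j ∈ J, red.hom (s j h) := by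
  rw [Finset.sum_apply, map_sum]

omit [TopologicalSpace G] [IsTopologicalGroup G] [U.Normal] in
/-- Scalars: `a • c` is trivialised by `a • s`, and `ρ̂(a • c, a • s) = a • ρ̂(c, s)`
(first component `red_smul`; second `red(a • s_h) = a • red(s_h)`). [folklore] -/
theorem rhoHat_smul_snd (a : R) (s : G → T) (h : G) :
    red.hom ((a • s) h) = a • red.hom (s h) := by
  rw [Pi.smul_apply, map_smul]

end Summit.BirchSwinnertonDyer.BirchSwinnertonDyer.Theorems.KimAtThreeD7uRefined

end
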